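import Literature.AlgebraicTopology.SingularHomology.LocallyFlatCriticalDegreeCharts
import Literature.AlgebraicTopology.SingularHomology.UniversalCoefficientsField
import HarnessLib

/-!
# The critical degree of the local homology at a connected, locally flat closed subset is generated by one class (the topological Thom class)

C. Voisin, *Hodge Theory and Complex Algebraic Geometry I* (CUP 2002), §11.1.2, proof of Lemma 11.13:
"the Thom isomorphism `Hʲ(X, X − Y) ≅ H^{j−2k}(Y)`" for a closed complex submanifold `Y` of
codimension `k` (tubular neighbourhood; Milnor–Stasheff §10); in the critical degree `j = 2k` and for
`Y` connected it says that `H^{2k}(X, X − Y) ≅ H⁰(Y)` is free of rank one on the Thom class. This file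
proves the homological, TOPOLOGICAL and ORIENTATION-FREE form of that statement, by the
local-to-global method of A. Hatcher, *Algebraic Topology* (2002), §3.3 (Lemma 3.27, proof of
Thm. 3.35), with no tubular neighbourhood:

* `exists_forall_mem_span_localHomologyOfSet_of_locallyFlat` — **let `X` be second countable,
  `S ⊆ X` closed and preconnected, `k ≥ 2`, and suppose every point of `S` lies in the source of an
  open partial homeomorphism `e : X ⇀ F × K` (real normed spaces depending on the point, `dim F`
  finite and `≥ k`) with `z ∈ S ↔ (e z).1 = 0` on `e.source`. Then `H_k(X | S; R) = H_k(X, X ∖ S; R)`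
  is `R · θ` for one class `θ`.**

Proof. `H_k(X | S)` is the sum of the images of the groups `H_k(B | S)` of the boxes `B` of the
charts (the tree's `localHomologyOfSet.mem_iSup_range_toAmbient_of_cover`; its vanishing hypothesis
in degree `k - 1` on all open sets is `isZero_localHomologyOfSet_of_locallyFlat`). Each image is
spanned by one class (`exists_range_toAmbient_box_eq_span`: `H_k(B | S) ≅ H_{k-1}(ℝⁿ ∖ 0)`). Two
boxes through a common point of `S` — of possibly different charts and model spaces — have the SAME
image (`range_toAmbient_box_eq_of_mem`: shrink a box of the first chart into the intersection
without changing its image, `range_toAmbient_box_eq_of_subset`, so that it factors through the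
second). Hence the image is locally constant along `S`, so constant by connectedness (the set of
points of `S` whose boxes have the image of a fixed box `B₀` and its complement in `S` are traces of
open sets), and the sum collapses to the image of `B₀`.

Consumer: purity of the coniveau pieces `ker (H²ᶜ(X(ℂ)) → H²ᶜ((X ∖ V)(ℂ)))` for an irreducible
subvariety `V` of codimension `c` (`HodgeTheory/SupportedClassesPurity`; Fulton 1998, §19.1
Lemma 19.1.1), via the straightening of `V(ℂ)` off a closed subset of larger codimension
(`HodgeTheory/ZariskiClosedStraightening`) and the connectedness of the straightened part
(Shafarevich VII §2 Thm. 7.1); and the cyclicity input isolated in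
`Barriers/HodgeConjecture/IntegralCoefficientsCurvePurity` (there asked in cohomology).
Everything is proved; no definitions, no named facts.

## References

* [VoisinHodgeI2002] C. Voisin, Hodge Theory and Complex Algebraic Geometry I, CUP 2002, §11.1.2
  Lemma 11.13 (proof).
* [HatcherAT2002] A. Hatcher, Algebraic Topology, CUP 2002, §3.3 Lemma 3.27, Prop. 3.33 and proof of
  Thm. 3.35.
* [Fulton1998] W. Fulton, Intersection Theory, 2nd ed. 1998, §19.1 Lemma 19.1.1.
-/

noncomputable section

open CategoryTheory Limits Set TopologicalSpace Metric

universe u v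

namespace Literature.AlgebraicTopology.SingularHomology

variable (R : Type v) [CommRing R] (M : Type v) [AddCommGroup M] [Module R M]

/-! ### The critical degree: `H_k(X | S; R)` is generated by one class for `S` connected -/

section Global

variable {X : Type} [TopologicalSpace X] {S : Set X}

/-- **Small boxes**: a point `s ∈ S` in the source of a straightening chart `e` has, inside any
open `O ∋ s` and below any radius bound `ρ > 0`, a box `e.source ∩ e⁻¹ B((0, (e s).2), r)` of `e`
with `0 < r ≤ ρ` and `B((0, (e s).2), r) ⊆ e '' (O ∩ e.source)`. [folklore] -/
theorem exists_box_subset {F K : Type} [NormedAddCommGroup F] [NormedAddCommGroup K]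
    (e : OpenPartialHomeomorph X (F × K)) (heS : ∀ z ∈ e.source, z ∈ S ↔ (e z).1 = 0)
    {s : X} (hs : s ∈ S) (hse : s ∈ e.source) {O : Set X} (hO : IsOpen O) (hsO : s ∈ O)
    {ρ : ℝ} (hρ : 0 < ρ) :
    ∃ r : ℝ, 0 < r ∧ r ≤ ρ ∧ ball ((0 : F), (e s).2) r ⊆ e.target ∧
      e.source ∩ e ⁻¹' ball ((0 : F), (e s).2) r ⊆ O ∧ s ∈ e.source ∩ e ⁻¹' ball ((0 : F), (e s).2) r := by
  have hs0 : (e s).1 = 0 := (heS s hse).1 hs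
  have hes : e s = ((0 : F), (e s).2) := Prod.ext hs0 rfl
  have hopen : IsOpen (e.target ∩ e.symm ⁻¹' (e.source ∩ O)) :=
    e.isOpen_inter_preimage_symm (e.open_source.inter hO)
  have hmem : e s ∈ e.target ∩ e.symm ⁻¹' (e.source ∩ O) :=
    ⟨e.map_source hse, by rw [mem_preimage, e.left_inv hse]; exact ⟨hse, hsO⟩⟩
  obtain ⟨r₀, hr₀, hball⟩ := Metric.isOpen_iff.1 hopen (e s) hmem
  refine ⟨min r₀ ρ, lt_min hr₀ hρ, min_le_right _ _, ?_, ?_, ⟨hse, ?_⟩⟩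
  · intro p hp
    rw [← hes] at hp
    exact (hball (ball_subset_ball (min_le_left _ _) hp)).1
  · rintro z ⟨hz, hzb⟩
    rw [mem_preimage, ← hes] at hzb
    have h := (hball (ball_subset_ball (min_le_left _ _) hzb)).2
    rw [mem_preimage, e.left_inv hz] at h
    exact h.2
  · rw [mem_preimage, ← hes]
    exact mem_ball_self (lt_min hr₀ hρ)

/-- **Two boxes through a common point of `S` have the same range in `H_k(X | S)`** (charts and
model spaces may differ): shrink a box of the first chart into the intersection
(`exists_box_subset`) without changing its range (`range_toAmbient_box_eq_of_subset`), so that it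
factors through the second box; and symmetrically. [folklore] -/
theorem range_toAmbient_box_eq_of_mem {F K : Type} [NormedAddCommGroup F] [NormedSpace ℝ F]
    [NormedAddCommGroup K] [NormedSpace ℝ K] {F' K' : Type} [NormedAddCommGroup F'] [NormedSpace ℝ F']
    [NormedAddCommGroup K'] [NormedSpace ℝ K']
    (e : OpenPartialHomeomorph X (F × K)) (heS : ∀ z ∈ e.source, z ∈ S ↔ (e z).1 = 0)
    (y : K) {r : ℝ} (hr : 0 < r) (hB : ball ((0 : F), y) r ⊆ e.target)
    (e' : OpenPartialHomeomorph X (F' × K')) (heS' : ∀ z ∈ e'.source, z ∈ S ↔ (e' z).1 = 0)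
    (y' : K') {r' : ℝ} (hr' : 0 < r') (hB' : ball ((0 : F'), y') r' ⊆ e'.target)
    {s : X} (hs : s ∈ S) (hsB : s ∈ e.source ∩ e ⁻¹' ball ((0 : F), y) r)
    (hsB' : s ∈ e'.source ∩ e' ⁻¹' ball ((0 : F'), y') r') {k : ℕ} (hk2 : 2 ≤ k) :
    LinearMap.range (localHomologyOfSet.toAmbient R M S (e.source ∩ e ⁻¹' ball ((0 : F), y) r) k).hom =
      LinearMap.range (localHomologyOfSet.toAmbient R M S (e'.source ∩ e' ⁻¹' ball ((0 : F'), y') r') k).hom := by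
  -- one inclusion, for an arbitrary pair of boxes
  suffices key : ∀ {F₁ K₁ : Type} [NormedAddCommGroup F₁] [NormedSpace ℝ F₁] [NormedAddCommGroup K₁]
      [NormedSpace ℝ K₁] {F₂ K₂ : Type} [NormedAddCommGroup F₂] [NormedSpace ℝ F₂]
      [NormedAddCommGroup K₂] [NormedSpace ℝ K₂]
      (e₁ : OpenPartialHomeomorph X (F₁ × K₁)) (_ : ∀ z ∈ e₁.source, z ∈ S ↔ (e₁ z).1 = 0)
      (y₁ : K₁) {r₁ : ℝ} (_ : 0 < r₁) (_ : ball ((0 : F₁), y₁) r₁ ⊆ e₁.target)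
      (e₂ : OpenPartialHomeomorph X (F₂ × K₂)) (y₂ : K₂) (r₂ : ℝ)
      {s : X} (_ : s ∈ S) (_ : s ∈ e₁.source ∩ e₁ ⁻¹' ball ((0 : F₁), y₁) r₁)
      (_ : s ∈ e₂.source ∩ e₂ ⁻¹' ball ((0 : F₂), y₂) r₂),
      LinearMap.range (localHomologyOfSet.toAmbient R M S (e₁.source ∩ e₁ ⁻¹' ball ((0 : F₁), y₁) r₁) k).hom ≤
        LinearMap.range (localHomologyOfSet.toAmbient R M S (e₂.source ∩ e₂ ⁻¹' ball ((0 : F₂), y₂) r₂) k).hom from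
    le_antisymm (key e heS y hr hB e' y' r' hs hsB hsB') (key e' heS' y' hr' hB' e y r hs hsB' hsB)
  intro F₁ K₁ _ _ _ _ F₂ K₂ _ _ _ _ e₁ heS₁ y₁ r₁ hr₁ hB₁ e₂ y₂ r₂ s hs hs₁ hs₂
  -- a small box of `e₁` through `s` inside both boxes, of radius `≤ r₁`
  have hO : IsOpen ((e₁.source ∩ e₁ ⁻¹' ball ((0 : F₁), y₁) r₁) ∩ (e₂.source ∩ e₂ ⁻¹' ball ((0 : F₂), y₂) r₂)) :=
    (e₁.isOpen_inter_preimage isOpen_ball).inter (e₂.isOpen_inter_preimage isOpen_ball)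
  obtain ⟨r, hr0, hrr, hBt, hBO, hsr⟩ := exists_box_subset e₁ heS₁ hs hs₁.1 hO ⟨hs₁, hs₂⟩ hr₁
  -- the small ball lies in the ball of the first box
  have hsub : ball ((0 : F₁), (e₁ s).2) r ⊆ ball ((0 : F₁), y₁) r₁ := by
    intro p hp
    have hp' : e₁.symm p ∈ e₁.source ∩ e₁ ⁻¹' ball ((0 : F₁), (e₁ s).2) r :=
      ⟨e₁.map_target (hBt hp), by rw [mem_preimage, e₁.right_inv (hBt hp)]; exact hp⟩
    have h := (hBO hp').1.2
    rw [mem_preimage, e₁.right_inv (hBt hp)] at h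
    exact h
  rw [← range_toAmbient_box_eq_of_subset R M e₁ heS₁ hr0 hrr hsub hB₁ hk2,
    ← localHomologyOfSet.inclMap_comp_toAmbient R M (fun z hz ↦ (hBO hz).2) k, ModuleCat.hom_comp,
    LinearMap.range_comp]
  exact LinearMap.map_le_range

/-- **The critical degree of the local homology at a connected, locally flat closed subset is
generated by ONE class** (the topological Thom class; C. Voisin, *Hodge Theory I*, §11.1.2, proof of
Lemma 11.13: "the Thom isomorphism `Hʲ(X, X − Y) ≅ H^{j−2k}(Y)`", here in the form that needs no
tubular neighbourhood and no orientation: for `Y` connected, `H_{2k}(X, X − Y)` is a quotient of the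
coefficient ring). Let `X` be second countable, `S ⊆ X` closed and preconnected, `k ≥ 2`, and
suppose every `s ∈ S` lies in the source of an open partial homeomorphism `e : X ⇀ F × K` (`F`, `K`
real normed spaces depending on the point, `dim F` finite and `≥ k`) straightening `S`:
`z ∈ S ↔ (e z).1 = 0` on `e.source`. Then there is `θ ∈ H_k(X | S; R) = H_k(X, X ∖ S; R)` with
`H_k(X | S; R) = R · θ`. Proof: `H_k(X | S)` is the sum of the images of the `H_k(B | S)` over the
boxes `B` of the charts (`localHomologyOfSet.mem_iSup_range_toAmbient_of_cover`, the vanishing in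
degree `k - 1` on all open sets being `isZero_localHomologyOfSet_of_locallyFlat`); each image is
spanned by one class (`exists_range_toAmbient_box_eq_span`: `H_k(B | S) ≅ H_{k-1}(ℝⁿ ∖ 0)` is `R`
or `0`); two boxes through a common point of `S` have the same image
(`range_toAmbient_box_eq_of_mem`), so the image is locally constant along `S`, hence constant.
[cite: VoisinHodgeI2002, §11.1.2 proof of Lemma 11.13] [cite: HatcherAT2002, §3.3 Lemma 3.27 and proof of Thm. 3.35] -/
theorem exists_forall_mem_span_localHomologyOfSet_of_locallyFlat [SecondCountableTopology X]
    (hS : IsClosed S) (hSc : IsPreconnected S) {k : ℕ} (hk2 : 2 ≤ k)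
    (hflat : ∀ x ∈ S, ∃ (F : Type) (_ : NormedAddCommGroup F) (_ : NormedSpace ℝ F)
      (_ : FiniteDimensional ℝ F) (K : Type) (_ : NormedAddCommGroup K) (_ : NormedSpace ℝ K)
      (e : OpenPartialHomeomorph X (F × K)),
      k ≤ Module.finrank ℝ F ∧ x ∈ e.source ∧ ∀ z ∈ e.source, z ∈ S ↔ (e z).1 = 0) :
    ∃ θ : localHomologyOfSet R R X S k, ∀ x, x ∈ Submodule.span R ({θ} : Set _) := by
  classical
  -- the boxes of the straightening charts
  let IsBox : Set X → Prop := fun B ↦ ∃ (F : Type) (_ : NormedAddCommGroup F) (_ : NormedSpace ℝ F)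
    (_ : FiniteDimensional ℝ F) (K : Type) (_ : NormedAddCommGroup K) (_ : NormedSpace ℝ K)
    (e : OpenPartialHomeomorph X (F × K)) (y : K) (r : ℝ), k ≤ Module.finrank ℝ F ∧
      (∀ z ∈ e.source, z ∈ S ↔ (e z).1 = 0) ∧ 0 < r ∧ ball ((0 : F), y) r ⊆ e.target ∧
      B = e.source ∩ e ⁻¹' ball ((0 : F), y) r
  let rg : Set X → Submodule R (localHomologyOfSet R R X S k) := fun B ↦
    LinearMap.range (localHomologyOfSet.toAmbient R R S B k).hom
  -- boxes are open and meet `S`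
  have hBopen : ∀ B, IsBox B → IsOpen B := by
    rintro B ⟨F, _, _, _, K, _, _, e, y, r, -, -, -, -, rfl⟩
    exact e.isOpen_inter_preimage isOpen_ball
  -- every point of `S` has boxes inside any open neighbourhood
  have hBex : ∀ s ∈ S, ∀ O : Set X, IsOpen O → s ∈ O → ∃ B, IsBox B ∧ s ∈ B ∧ B ⊆ O := by
    intro s hs O hO hsO
    obtain ⟨F, i₁, i₂, i₃, K, i₄, i₅, e, hkF, hse, heS⟩ := hflat s hs
    obtain ⟨r, hr0, -, hBt, hBO, hsr⟩ := exists_box_subset e heS hs hse hO hsO zero_lt_one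
    exact ⟨_, ⟨F, i₁, i₂, i₃, K, i₄, i₅, e, (e s).2, r, hkF, heS, hr0, hBt, rfl⟩, hsr, hBO⟩
  -- two boxes through a common point of `S` have the same range
  have hBeq : ∀ B B', IsBox B → IsBox B' → ∀ s ∈ S, s ∈ B → s ∈ B' → rg B = rg B' := by
    rintro B B' ⟨F, _, _, _, K, _, _, e, y, r, -, heS, hr, hB, rfl⟩
      ⟨F', _, _, _, K', _, _, e', y', r', -, heS', hr', hB', rfl⟩ s hs hsB hsB'
    exact range_toAmbient_box_eq_of_mem R R e heS y hr hB e' heS' y' hr' hB' hs hsB hsB' hk2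
  -- each range is spanned by one class
  have hBspan : ∀ B, IsBox B → ∃ θ, rg B = Submodule.span R {θ} := by
    rintro B ⟨F, _, _, _, K, _, _, e, y, r, hkF, heS, hr, hB, rfl⟩
    exact exists_range_toAmbient_box_eq_span R e heS y hr hB hk2 hkF
  -- generation by the boxes
  have hgen : ∀ x : localHomologyOfSet R R X S k, x ∈ ⨆ B ∈ {B | IsBox B}, rg B := by
    intro x
    refine localHomologyOfSet.mem_iSup_range_toAmbient_of_cover R R (S := S) hS k
      (fun W hW j hj ↦ isZero_localHomologyOfSet_of_locallyFlat R R hS k hflat hW (by omega) (by omega))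
      (fun B hB ↦ hBopen B hB) (fun s hs ↦ ?_) x
    obtain ⟨B, hB, hsB, -⟩ := hBex s hs univ isOpen_univ (mem_univ s)
    exact mem_sUnion_of_mem hsB hB
  -- the empty case
  by_cases hSe : S = ∅
  · subst hSe
    refine ⟨0, fun x ↦ ?_⟩
    have hx := hgen x
    have h0 : (⨆ B ∈ {B | IsBox B}, rg B) = ⊥ := by
      refine (iSup₂_eq_bot).2 fun B hB ↦ ?_
      obtain ⟨F, _, _, _, K, _, _, e, y, r, -, heS, hr, hBt, rfl⟩ := hB
      exact absurd ((heS _ (e.map_target (hBt (mem_ball_self hr)))).2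
        (by rw [e.right_inv (hBt (mem_ball_self hr))])) (notMem_empty _)
    rw [h0, Submodule.mem_bot] at hx
    rw [hx]
    exact Submodule.zero_mem _
  -- a base box `B₀` through a point `s₀ ∈ S`
  obtain ⟨s₀, hs₀⟩ := nonempty_iff_ne_empty.2 hSe
  obtain ⟨B₀, hB₀, hs₀B₀, -⟩ := hBex s₀ hs₀ univ isOpen_univ (mem_univ s₀)
  -- the set of points of `S` at which the boxes have the range of `B₀` is clopen in `S`, hence all of `S`
  let A : Set X := {s | s ∈ S ∧ ∃ B, IsBox B ∧ s ∈ B ∧ rg B = rg B₀}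
  have hAS : S ⊆ A := by
    -- the open sets `U ⊇ A` and `V ⊇ S ∖ A`
    let U : Set X := ⋃₀ {B | IsBox B ∧ rg B = rg B₀}
    let V : Set X := ⋃₀ {B | IsBox B ∧ rg B ≠ rg B₀}
    have hU : IsOpen U := isOpen_sUnion fun B hB ↦ hBopen B hB.1
    have hV : IsOpen V := isOpen_sUnion fun B hB ↦ hBopen B hB.1
    have hcov : S ⊆ U ∪ V := by
      intro s hs
      obtain ⟨B, hB, hsB, -⟩ := hBex s hs univ isOpen_univ (mem_univ s)
      by_cases h : rg B = rg B₀
      · exact Or.inl (mem_sUnion_of_mem hsB ⟨hB, h⟩)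
      · exact Or.inr (mem_sUnion_of_mem hsB ⟨hB, h⟩)
    have hdisj : ¬ (S ∩ (U ∩ V)).Nonempty := by
      rintro ⟨s, hs, hsU, hsV⟩
      obtain ⟨B, ⟨hB, hBr⟩, hsB⟩ := mem_sUnion.1 hsU
      obtain ⟨B', ⟨hB', hB'r⟩, hsB'⟩ := mem_sUnion.1 hsV
      exact hB'r ((hBeq B' B hB' hB s hs hsB' hsB).trans hBr)
    have hSV : ¬ (S ∩ V).Nonempty := fun hne ↦
      hdisj (hSc U V hU hV hcov ⟨s₀, hs₀, mem_sUnion_of_mem hs₀B₀ ⟨hB₀, rfl⟩⟩ hne)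
    intro s hs
    rcases hcov hs with hsU | hsV
    · obtain ⟨B, ⟨hB, hBr⟩, hsB⟩ := mem_sUnion.1 hsU
      exact ⟨hs, B, hB, hsB, hBr⟩
    · exact absurd ⟨s, hs, hsV⟩ hSV
  -- hence every box has the range of `B₀`
  have hall : ∀ B, IsBox B → rg B = rg B₀ := by
    intro B hB
    obtain ⟨F, i₁, i₂, i₃, K, i₄, i₅, e, y, r, hkF, heS, hr, hBt, rfl⟩ := hB
    -- the centre of the box lies on `S`
    have hc : e.symm ((0 : F), y) ∈ S :=
      (heS _ (e.map_target (hBt (mem_ball_self hr)))).2 (by rw [e.right_inv (hBt (mem_ball_self hr))])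
    have hcB : e.symm ((0 : F), y) ∈ e.source ∩ e ⁻¹' ball ((0 : F), y) r :=
      ⟨e.map_target (hBt (mem_ball_self hr)), by
        rw [mem_preimage, e.right_inv (hBt (mem_ball_self hr))]; exact mem_ball_self hr⟩
    obtain ⟨-, B', hB', hcB', hB'r⟩ := hAS hc
    rw [← hB'r]
    exact hBeq _ B' ⟨F, i₁, i₂, i₃, K, i₄, i₅, e, y, r, hkF, heS, hr, hBt, rfl⟩ hB' _ hc hcB hcB'
  -- conclusion
  obtain ⟨θ, hθ⟩ := hBspan B₀ hB₀
  refine ⟨θ, fun x ↦ ?_⟩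
  have hx := hgen x
  have hle : (⨆ B ∈ {B | IsBox B}, rg B) ≤ Submodule.span R {θ} :=
    iSup₂_le fun B hB ↦ ((hall B hB).trans hθ).le
  exact hle hx

end Global

/-! ### From the critical local homology to kernels of restriction in cohomology (over a field) -/

section Cohomology

variable {Y : Type} [TopologicalSpace Y]

/-- **If `H_m(Y | S; F)` is generated by one class then the classes of `Hᵐ(Y; F)` dying on `Y ∖ S`
are the multiples of one class**, over a field `F`. By universal coefficients (Hatcher Thm. 3.2, the
tree's `kroneckerPairing_injective_of_field`) a class `x` is its functional `⟨x, –⟩` on `H_m(Y)`;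
if `x` dies on `Y ∖ S` the functional vanishes on the image of `H_m(Y ∖ S)`, which is the kernel of
`H_m(Y) → H_m(Y, Y ∖ S) = F · θ` (exact sequence of the pair), so it factors through a line: two
such functionals are proportional. [cite: HatcherAT2002, §3.1 Thm. 3.2 and §2.1 Thm. 2.16] -/
theorem exists_ker_cohomologyMap_le_span_of_localHomologyOfSet (F : Type) [Field F] (S : Set Y)
    (m : ℕ) (h : ∃ θ : localHomologyOfSet F F Y S m, ∀ x, x ∈ Submodule.span F ({θ} : Set _)) :
    ∃ τ : singularCohomology F F Y m,
      LinearMap.ker (singularCohomology.map F F (subsetIncl Sᶜ) m).hom ≤ Submodule.span F {τ} := by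
  obtain ⟨θ, hθ⟩ := h
  set κ := kroneckerPairing F F Y m with hκ
  have hκinj := kroneckerPairing_injective_of_field F Y m
  -- exactness of `H_m(Y ∖ S) → H_m(Y) → H_m(Y | S)`
  have hex : ∀ u : singularHomology F F Y m, relativeSingularHomology.ofAbsolute F F Y Sᶜ m u = 0 →
      ∃ w, singularHomology.map F F (subsetIncl Sᶜ) m w = u := fun u hu ↦
    ((ShortComplex.moduleCat_exact_iff _).1
      (relativeSingularHomology.exact_map_ofAbsolute F F (X := Y) Sᶜ m)) u hu
  -- a class dying on `Y ∖ S` pairs to zero with the image of `H_m(Y ∖ S)`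
  have hvan : ∀ x ∈ LinearMap.ker (singularCohomology.map F F (subsetIncl Sᶜ) m).hom,
      ∀ u : singularHomology F F Y m, relativeSingularHomology.ofAbsolute F F Y Sᶜ m u = 0 →
        κ x u = 0 := by
    intro x hx u hu
    obtain ⟨w, rfl⟩ := hex u hu
    rw [hκ, ← kroneckerPairing_map, LinearMap.mem_ker.1 hx, map_zero, LinearMap.zero_apply]
  by_cases hK : LinearMap.ker (singularCohomology.map F F (subsetIncl Sᶜ) m).hom = ⊥
  · exact ⟨0, by rw [hK]; exact bot_le⟩
  obtain ⟨x₀, hx₀K, hx₀⟩ := (Submodule.ne_bot_iff _).1 hK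
  refine ⟨x₀, fun x hx ↦ ?_⟩
  -- a homology class on which `⟨x₀, –⟩` does not vanish
  have hκx₀ : κ x₀ ≠ 0 := fun h0 ↦ hx₀ (hκinj (by rw [← hκ, h0, map_zero]))
  obtain ⟨u₀, hu₀⟩ : ∃ u₀, κ x₀ u₀ ≠ 0 := by
    by_contra hall
    push Not at hall
    exact hκx₀ (LinearMap.ext hall)
  obtain ⟨a, ha⟩ := Submodule.mem_span_singleton.1
    (hθ (relativeSingularHomology.ofAbsolute F F Y Sᶜ m u₀))
  have ha0 : a ≠ 0 := by
    rintro rfl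
    rw [zero_smul, eq_comm] at ha
    exact hu₀ (hvan x₀ hx₀K u₀ ha)
  -- `⟨x, –⟩` is proportional to `⟨x₀, –⟩`
  have hprop : ∀ u, κ x u = (κ x u₀ / κ x₀ u₀) * κ x₀ u := by
    intro u
    obtain ⟨b, hb⟩ := Submodule.mem_span_singleton.1
      (hθ (relativeSingularHomology.ofAbsolute F F Y Sᶜ m u))
    have hz : relativeSingularHomology.ofAbsolute F F Y Sᶜ m (u - (b / a) • u₀) = 0 := by
      rw [map_sub, map_smul, ← hb, ← ha, smul_smul, div_mul_cancel₀ b ha0, sub_self]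
    have h1 := hvan x hx _ hz
    have h2 := hvan x₀ hx₀K _ hz
    rw [map_sub, map_smul, sub_eq_zero, smul_eq_mul] at h1 h2
    rw [h1, h2]
    field_simp
  refine Submodule.mem_span_singleton.2 ⟨κ x u₀ / κ x₀ u₀, hκinj ?_⟩
  rw [← hκ, map_smul]
  exact (LinearMap.ext fun u ↦ by rw [LinearMap.smul_apply, smul_eq_mul, hprop u]).symm

end Cohomology

end Literature.AlgebraicTopology.SingularHomology

end
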